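/-
Copyright: lit-balaban cell, Phase-2 proof seat p24 (gen 25).  Released under Apache 2.0 license as described in the
file LICENSE.
-/
import Literature.MathematicalPhysics.QuantumFieldTheory.Balaban1983to89.B3GkZeroLattice
import Literature.MathematicalPhysics.QuantumFieldTheory.Balaban1983to89.B4Eq246SquareSummable
import Literature.MathematicalPhysics.QuantumFieldTheory.Balaban1983to89.B4Ineq227LatticeL2

/-!
# `Balaban1983to89.B4Thm110ZeroLattice` — [Balaban1983RegularityDecay] Theorem p. 573, THE VALUE CLAUSE OF (1.10), FOR
# `Ω =` THE WHOLE LATTICE `ηℤ^{d+1}`, `A = 0`; and the `ℓ²` bridge «`G_k(0)` of [Balaban1983Higgs3] p. 433 `=` the free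
# propagator `G_j` of (2.44)–(2.46)», with (1.8)/(2.28) positivity for `G_k(0)`

statement-level skeleton of published theorems with citation tags; proofs where landed; nothing here is a claim about
the Yang–Mills mass gap

CITATION HEADER.  T. Bałaban, *Regularity and decay of lattice Green's functions*, Commun. Math. Phys. **89** (1983)
571–597, doi:10.1007/bf01214744 [Balaban1983RegularityDecay] (cell paper B4; held text
`paper:balaban1983-cmp89-regularity-decay`, journal page = PDF page + 570): p. 572 [PDF 2] (1.6), p. 573 [PDF 3] (1.8) and
the Theorem with (1.10), p. 577–578 [PDF 7–8] Lemma 2.2 (2.17), p. 580 [PDF 10] (2.28), p. 584 [PDF 14] (2.44)–(2.46);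
T. Bałaban, *(Higgs)₂,₃ quantum fields in a finite volume. III. Renormalization*, Commun. Math. Phys. **88** (1983) 411–445
[Balaban1983Higgs3] (cell paper B3), p. 433 [PDF 23] («we substitute G_k(□,0) = G_k(0) + δG_k(□,ηZ^d,0)»).  Unit
`lit-balaban-p24` gen 25; HOME `run/shared/lean/pub/lit-balaban/`; SKELETON rows **B4.Thm@573**, **B4.Eq2.43**
((2.44)–(2.46)), **B4.Eq2.27** ((2.28)) (owner r01) and **B3.Txt@433** (owner r15) — cells only, all proved-headed.

WHAT IS PRINTED.  [B4] p. 572: «We consider subsets Ω which are unions of big blocks.» … «G_k(Ω, A) =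
(−Δ^{η,N}_{A,Ω} + m² + aP_k(A))^{−1}, (1.6) where m² ≧ 0 and a is a positive constant close to 1».  p. 573: «The operator
defining the Green's function (1.6) has a strictly positive lower bound. … −Δ^η_{A,Ω} + aP_k(A) ≧ γ₀I. (1.8) The constant
γ₀ is independent of the lattice spacing η, as well as of Ω and of A.» … «**Theorem** (Proposition 2.1 of [1]). For α < 1
there exist positive constants δ₀, c₀, R₀ independent of A, k, Ω and depending on d, M only, c₀ on α also, such that
for e sufficiently small and for an arbitrary function f : Ω → R^N, we have … |(D^η_{A,μ}G_k(Ω,A)f)(x)|, |(G_k(Ω,A)f)(x)|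
≦ c₀ exp(−δ₀ dist(x, supp f))‖f‖_∞ (1.10) for x ∈ Ω, dist(x, Ω^c) ≧ R₀.»  p. 578, Lemma 2.2: «‖G_k(□,Ã)f‖_q, … ≦ c₂‖f‖_p
(2.17) for 1 ≦ p, q ≦ ∞ …».  p. 580: «0 < G_k(□,0) ≦ c₀I, … hence ‖G_k(□,0)f‖₂ ≦ c₀‖f‖₂. (2.28)».  p. 584: «(−Δ^ξ + m_j²
+ a_jQ_j^*Q_j)φ₀ = f. (2.44) … Solving the above equations we get (2.46) … Defining the propagator G_j, φ₀ = G_jf».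
[B3] p. 433: «Finally we replace the scalar field propagator G_k(□,0) by G_k(0), i.e. we substitute G_k(□,0) = G_k(0) +
δG_k(□,ηZ^d,0)».

THE OBJECT.  `Ω = ηℤ^{d+1}` is itself a union of big blocks and `dist(x, Ω^c) ≧ R₀` is then vacuous, so the Theorem speaks
of the propagator (1.6) on the whole lattice.  At `A = 0` the tree holds this propagator TWICE: (α) as the KERNEL
`B3GkZeroLattice.GkLat ℓ k a m² x x′ = G_k(0)(x,x′)` (p03 g8), the `t → ∞` limit of the Neumann-cube propagators
`G_k(C_t,0)` (`gcube`, `tendsto_gcube`), symmetric (`GkLat_comm`), block-translation invariant (`GkLat_shift`), with the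
lattice Green identity `green_GkLat`; its module docstring declares «not as a bounded operator on ℓ²(ηℤ^{d+1}); uniqueness
among bounded solutions, positivity … NOT claimed»; (β) as the OPERATOR `B4Eq246SolvesEq244.G246 n a m² f` (p24 g23/24),
the inverse Fourier transform of (2.46), THE square-summable solution of (2.44) for `f ∈ ℓ¹`, `m² > 0`
(`B4Eq246SquareSummable.existsUnique_l2_solution`), whose pointwise decay was not in the tree.

WHAT THIS MODULE PROVES (kernel-checked; theorems only; 0 `def`; 0 `sorry`; axioms standard).  Matrix units of the
zero-field lineage throughout (`n = L^k = η^{−1}` fine points per unit block, `L = ℓ + 1 ≥ 2`, running coefficient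
`a_k = B1.aSeq a L k`, window `a ∈ [a₋,a₊]` (`a₋ > 0`), `m² ∈ [0,m²₊]`; the physical kernel is `η^{−(d+1)}·GkLat`, and
`(G_k(0)f)(x) = Σ_{x′} GkLat(x,x′)f(x′)` with the `η^{d+1}` of the `ℓ²_η` pairing cancelled, as in `B4Thm110ZeroBox`):
* §1 **(1.10), VALUE CLAUSE, `Ω = ηℤ^{d+1}` — THE UNIFORM WEIGHTED ROW BOUND** `GkLat_weightedRow_le`: there are `δ₀, c₀ > 0`
  (on `d`, `L`, the window) with `Σ_{x′ ∈ F}|G_k(0)(x,x′)|·e^{δ₀|x−x′|_∞/n} ≤ c₀` for every finite `F ⊂ ℤ^{d+1}`, every row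
  `x`, every `k ≥ 1` and window point — `B4Thm110ZeroBox.Gfine_roww_bound` (the box theorem, whose constants do not see
  the box) on the centred cubes `C_t`, passed through `tendsto_gcube`; hence `GkLat_weightedRow_summable` /
  `GkLat_weightedRow_tsum_le` (the full series), `GkLat_abs_le` (`|G_k(0)(x,x′)| ≤ c₀e^{−δ₀|x−x′|_∞/n}`, every `d`),
  `GkLat_row_summable` / `GkLat_weightedCol_le` (Lemma 2.2 (2.17) at `p = q = ∞` and `p = q = 1` on the lattice:
  `Σ_{x′}|G_k(0)(x,x′)| ≤ c₀`, `Σ_x|G_k(0)(x,x′)| ≤ c₀`, by the symmetry `GkLat_comm`), and THE PRINTED SHAPE `GkLat_apply_le`: for every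
  bounded `f` on `ηℤ^{d+1}` (`‖f‖ ≤ F_∞`) and every `D ≤ |x − x′|_∞` on `supp f`, the series `Σ_{x′}G_k(0)(x,x′)f(x′)`
  converges absolutely and `|(G_k(0)f)(x)| ≤ c₀e^{−δ₀D/n}F_∞`.
* §2 **THE `ℓ²` BRIDGE.**  `opD_GkLat_col`: the columns `z ↦ G_k(0)(z,x′)` solve `B4Green244.opD n a_k m² (G_k(0)(·,x′)) = δ_{x′}`
  (p03's `green_GkLat` through the dictionary `latOpK ↔ opK ↔ opD`, `B4Green242Bridge.opK_dictionary`); they are summable and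
  square-summable (`summable_GkLat_col`, `summable_sq_GkLat_col`); hence **`eq_GkLat_col_of_opD_eq`**: EVERY square-summable
  solution of `Dφ = δ_{x′}` IS the column of `G_k(0)` (`B4Ineq227LatticeL2.opD_injective_l2_of_pos`) — `G_k(0)` does not
  depend on the exhaustion and is the kernel of THE bounded inverse of (1.6) on `ℓ²(ηℤ^{d+1})`; and for `m² > 0`
  **`GkLat_col_eq_G246`**: `G_k(0)(·,x′) = G246 n a_k m² δ_{x′}` — the thermodynamic-limit propagator of [B3] p. 433 IS the
  Fourier-built free propagator (2.46) of [B4] («φ₀ = G_jf» for `f = δ_{x′}`); consequently `G246_kernel_abs_le`: the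
  (2.46)-propagator's kernel obeys (1.10), `|(G246 n a m² δ_{x′})(x)| ≤ c₀e^{−δ₀|x−x′|_∞/n}` for every literal coefficient
  `a ∈ [a₋,a₊]` (`a = (a/c_k)_k`, `B4Thm110ZeroBox.aSeq_div_cK`), `GkLat_apply_finsupp` (`G_k(0)f ∈ ℓ¹ ∩ ℓ²` solves
  `D(G_k(0)f) = f` for finitely supported `f`) and `GkLat_apply_eq_G246`: `G_k(0)f = G246 f` for such `f`, `m² > 0`.
* §3 **(1.8)/(2.28) FOR `G_k(0)`** on finitely supported data: `GkLat_form_lower`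
  (`(min{8,a_k} + m²)‖G_k(0)f‖²_{ℓ²} ≤ Re⟨G_k(0)f, f⟩`, `B4Ineq227LatticeL2.energy_lower_bound_l2` at `φ = G_k(0)f`,
  `Dφ = f`), `GkLat_apply_l2_bound` («‖G_k(□,0)f‖₂ ≦ c₀‖f‖₂», `c₀⁻¹ = min{8,a_k} + m²`, `norm_opD_ge`), `GkLat_form_nonneg`
  («0 < G_k», `Re Σ_{x,x′} f̄(x)G_k(0)(x,x′)f(x′) ≥ 0`) and `GkLat_form_pos` (strict for `f ≠ 0`).  REPAIRED CONSTANT: print's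
  `c₀⁻¹ = min{π², a_k}` of (2.28) rests on the continuum Neumann gap «π²» of the sentence before (2.27), false for the lattice
  block operator (gap `∈ [8, π²[`); the lineage's constant is `min{8,a} + m²` (census G-B4-03 of HOME/GAPS.md, named in front in
  `B4Ineq227LatticeL2` / `B4Ineq228OperatorOrder`), and it is the one used here.
* §4 non-vacuity at `d + 1 = 4`, `L = 2`, `a ∈ [1/2, 2]`, `m² ∈ [0, 1]`.

DICTIONARY / HONEST SCOPE.  (i) `A = 0`, one component, `Ω = ηℤ^{d+1}`, all `k ≥ 1`, `L ≥ 2`; distances in the sup norm and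
lattice units `/n` (print: Euclidean `dist`, so the printed exponent follows with `δ₀/√(d+1)`); constants existential on `d`,
`L`, the window (print: «depending on d, M only»).  (ii) ROUTE (declared divergence): the print proves the Theorem for a
general union of big blocks `Ω` by the random-walk expansion over `M`-cubes (§2, (2.12)–(2.13)); the member `Ω = ηℤ^{d+1}`,
`A = 0` is obtained here from the LANDED box theorem (the print's own box route (2.34) + Lemma 2.4, `B4Thm110ZeroBox`) in
the infinite-volume limit already built by p03 (`tendsto_gcube`) — a shorter road inside the tree, not the printed one.
(iii) The derivative and Hölder clauses of (1.9)/(1.10) on the lattice are not repeated here (kernel forms at `d + 1 = 3`: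
`B3GkZeroLatticePointwise`, `B3GkZeroLatticeSeparated`).  (iv) The identification with the `m² = 0 < a` solutions of
`B4Eq16FreePropagatorL2` (p371266, pending at the time of writing) is by `eq_GkLat_col_of_opD_eq` once that module is in the
tree; nothing of it is used.  (v) Value = kernel certificate of (1.10) for the free infinite-lattice propagator and the
identification of the tree's two constructions of it; cells only; NOT summit progress.
-/

namespace Literature.MathematicalPhysics.QuantumFieldTheory.Balaban1983to89.B4Thm110ZeroLattice

open Finset Filter Topology Complex
open Literature.MathematicalPhysics.QuantumFieldTheory.Balaban1983to89.B4ContourShift (supNorm supNorm_nonneg)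
open Literature.MathematicalPhysics.QuantumFieldTheory.Balaban1983to89.B4TwoRegion120 (supNorm_sub_comm)
open Literature.MathematicalPhysics.QuantumFieldTheory.Balaban1983to89.B4Reflection242
open Literature.MathematicalPhysics.QuantumFieldTheory.Balaban1983to89.B4BoxCov237
open Literature.MathematicalPhysics.QuantumFieldTheory.Balaban1983to89.B4Thm110ZeroBox
open Literature.MathematicalPhysics.QuantumFieldTheory.Balaban1983to89.B3GkZeroLattice
open Literature.MathematicalPhysics.QuantumFieldTheory.Balaban1983to89.B4Green244 (opD opD_eq_stencil)
open Literature.MathematicalPhysics.QuantumFieldTheory.Balaban1983to89.B4Green242Bridge (opK_dictionary)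
open Literature.MathematicalPhysics.QuantumFieldTheory.Balaban1983to89.B4Ineq227LatticeL2
open Literature.MathematicalPhysics.QuantumFieldTheory.Balaban1983to89.B4Eq246SolvesEq244 (G246 opD_G246)
open Literature.MathematicalPhysics.QuantumFieldTheory.Balaban1983to89.B4Eq246SquareSummable
open scoped ComplexConjugate

noncomputable section

variable {d : ℕ}

/-! ## §0 Kernel helpers -/

/-- kernel: `L^k ≥ 1`. [folklore] -/
private theorem one_le_n (ℓ k : ℕ) : 1 ≤ (ℓ + 1) ^ k := Nat.one_le_pow _ _ (by omega)

/-- kernel: an injective relabelling of a finite partial sum of non-negative terms is dominated by the full finite sum.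
[folklore] -/
private theorem sum_attach_le_univ_sum {α β : Type*} [Fintype β] [DecidableEq β] (F : Finset α) (ι : ↥F → β)
    (hι : Function.Injective ι) (g : β → ℝ) (hg : ∀ b, 0 ≤ g b) :
    ∑ a ∈ F.attach, g (ι a) ≤ ∑ b, g b := by
  classical
  rw [← Finset.sum_image (f := g) (fun a _ b _ h => hι h)]
  exact Finset.sum_le_univ_sum_of_nonneg hg

/-- kernel: a common label radius for a point and a finite set of points. [folklore] -/
private theorem exists_labRad_finset (n : ℕ) (x : Fin (d + 1) → ℤ) (F : Finset (Fin (d + 1) → ℤ)) :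
    ∃ R : ℕ, LabRad n R x ∧ ∀ x' ∈ F, LabRad n R x' := by
  refine ⟨∑ i, (blk n x i).natAbs + ∑ x' ∈ F, ∑ i, (blk n x' i).natAbs,
    (labRad_sum n x).mono (Nat.le_add_right _ _), fun x' hx' => (labRad_sum n x').mono ?_⟩
  exact le_trans (Finset.single_le_sum (f := fun y => ∑ i, (blk n y i).natAbs) (fun _ _ => Nat.zero_le _) hx')
    (Nat.le_add_left _ _)

/-- kernel: `D` is linear over finite combinations (finite stencil). [folklore] -/
private theorem opD_finset_sum_mul {ι : Type*} (S : Finset ι) (n : ℕ) (A m2 : ℝ) (c : ι → ℂ)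
    (g : ι → (Fin (d + 1) → ℤ) → ℂ) (x : Fin (d + 1) → ℤ) :
    opD n A m2 (fun z => ∑ i ∈ S, g i z * c i) x = ∑ i ∈ S, opD n A m2 (g i) x * c i := by
  simp only [opD_eq_stencil, Finset.mul_sum, Finset.sum_mul]
  rw [Finset.sum_comm]
  refine Finset.sum_congr rfl fun i _ => Finset.sum_congr rfl fun j _ => by ring

/-- kernel: the real lattice operator `latOpK` of `B3GkZeroLattice` is the complex kernel `opK` of `B4Reflection242` at the
coefficients of (2.44). [folklore] -/
private theorem opK_eq_ofReal_latOpK (n : ℕ) (A m2 : ℝ) (x z : Fin (d + 1) → ℤ) :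
    opK ((n : ℂ) ^ 2) (m2 : ℂ) ((A : ℂ) * ((n : ℂ) ^ (d + 1))⁻¹) n x z = ((latOpK n A m2 x z : ℝ) : ℂ) := by
  simp only [opK, latOpK, lapK, diagK, avgK]
  split_ifs <;> push_cast <;> ring

/-! ## §1 (1.10), value clause, for `Ω = ηℤ^{d+1}`: the uniform weighted row bound for `G_k(0)` and its consequences -/

/-- **(1.10) FOR `Ω = ηℤ^{d+1}`, `A = 0` — THE UNIFORM WEIGHTED ROW BOUND, finite partial sums.**  There are `δ₀, c₀ > 0`
(depending on `d`, `L = ℓ + 1` and the window only) such that for every `k ≥ 1`, `a ∈ [a₋,a₊]`, `m² ∈ [0,m²₊]`, every row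
`x` and every finite `F ⊂ ℤ^{d+1}`: `Σ_{x′ ∈ F} |G_k(0)(x,x′)|·e^{δ₀|x−x′|_∞/L^k} ≤ c₀` — the box theorem
`B4Thm110ZeroBox.Gfine_roww_bound` on the centred cubes `C_t ⊃ {x} ∪ F`, in the limit `t → ∞` (`B3GkZeroLattice.tendsto_gcube`).
[cite: Balaban1983RegularityDecay, Theorem (Prop. 2.1 of [1]) (1.10) p.573 with (1.6) p.572; dictionary (Ω = ηℤ^{d+1}, A = 0)] -/
theorem GkLat_weightedRow_le (d ℓ : ℕ) (hℓ : 1 ≤ ℓ) (amin aplus m2plus : ℝ) (ha : 0 < amin) :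
    ∃ δ₀ c₀ : ℝ, 0 < δ₀ ∧ 0 < c₀ ∧ ∀ (k : ℕ), 1 ≤ k → ∀ (a m2 : ℝ), amin ≤ a → a ≤ aplus → 0 ≤ m2 → m2 ≤ m2plus →
      ∀ (x : Fin (d + 1) → ℤ) (F : Finset (Fin (d + 1) → ℤ)),
        ∑ x' ∈ F, |GkLat ℓ k a m2 x x'| * Real.exp (δ₀ * supNorm (x - x') / (((ℓ + 1) ^ k : ℕ) : ℝ)) ≤ c₀ := by
  obtain ⟨δ₀, c₀, hδ₀, hc₀, h⟩ := Gfine_roww_bound d ℓ hℓ amin aplus m2plus ha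
  refine ⟨δ₀, c₀, hδ₀, hc₀, ?_⟩
  intro k hk a m2 h1 h2 h3 h4 x F
  have hn := one_le_n ℓ k
  have ha' : 0 < a := ha.trans_le h1
  obtain ⟨R, hxR, hFR⟩ := exists_labRad_finset ((ℓ + 1) ^ k) x F
  -- the finite partial sums along the cubes `C_t`, `t ≥ R`, are dominated by the weighted box rows
  have hB : ∀ t, R ≤ t → ∑ x' ∈ F, |gcube ℓ k t a m2 x x'|
      * Real.exp (δ₀ * supNorm (x - x') / (((ℓ + 1) ^ k : ℕ) : ℝ)) ≤ c₀ := by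
    intro t ht
    have hxm := ctr_mem (d := d) hn ht hxR
    have hFm : ∀ x' ∈ F, ctr ((ℓ + 1) ^ k) t x' ∈ boxDom (Nf ℓ k (cubeM (d := d) t)) :=
      fun x' hx' => ctr_mem (d := d) hn ht (hFR x' hx')
    set G := Gfine ℓ k (cubeM (d := d) t) k a m2 with hG
    set g : ↥(boxDom (Nf ℓ k (cubeM (d := d) t))) → ℝ := fun y =>
      |G ⟨_, hxm⟩ y| * Real.exp (δ₀ * supNorm (ctr ((ℓ + 1) ^ k) t x - y.1) / (((ℓ + 1) ^ k : ℕ) : ℝ)) with hg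
    have hroww : ∑ y, g y ≤ c₀ := h k hk k hk le_rfl a m2 h1 h2 h3 h4 (cubeM t) (cubeM_pos t) ⟨_, hxm⟩
    set ι : ↥F → ↥(boxDom (Nf ℓ k (cubeM (d := d) t))) := fun y => ⟨ctr ((ℓ + 1) ^ k) t y.1, hFm y.1 y.2⟩ with hι
    have hinj : Function.Injective ι := by
      intro y₁ y₂ hy
      have h' : ctr ((ℓ + 1) ^ k) t y₁.1 = ctr ((ℓ + 1) ^ k) t y₂.1 := congrArg Subtype.val hy
      exact Subtype.ext (add_left_injective _ h')
    have hsum : ∑ x' ∈ F, |gcube ℓ k t a m2 x x'| * Real.exp (δ₀ * supNorm (x - x') / (((ℓ + 1) ^ k : ℕ) : ℝ))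
        = ∑ y ∈ F.attach, g (ι y) := by
      rw [← Finset.sum_attach]
      refine Finset.sum_congr rfl fun y _ => ?_
      simp only [hg, hι, gcube_eq hxm (hFm y.1 y.2), ctr_sub_ctr, hG]
    rw [hsum]
    exact (sum_attach_le_univ_sum F ι hinj g fun y => mul_nonneg (abs_nonneg _) (Real.exp_pos _).le).trans hroww
  -- pass to the limit `t → ∞`
  have hlim : Tendsto (fun t => ∑ x' ∈ F, |gcube ℓ k t a m2 x x'|
      * Real.exp (δ₀ * supNorm (x - x') / (((ℓ + 1) ^ k : ℕ) : ℝ))) atTop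
      (𝓝 (∑ x' ∈ F, |GkLat ℓ k a m2 x x'| * Real.exp (δ₀ * supNorm (x - x') / (((ℓ + 1) ^ k : ℕ) : ℝ)))) :=
    tendsto_finsetSum F fun x' _ => ((tendsto_gcube hℓ hk ha' h3 x x').abs).mul_const _
  exact le_of_tendsto hlim (eventually_atTop.2 ⟨R, hB⟩)

section Consequences

variable {ℓ k : ℕ} {a m2 δ₀ c₀ : ℝ}

/-- **THE FULL WEIGHTED ROW SERIES CONVERGES** whenever its finite partial sums are bounded (as delivered by
`GkLat_weightedRow_le`): `x′ ↦ |G_k(0)(x,x′)|·e^{δ₀|x−x′|_∞/L^k}` is summable over `ℤ^{d+1}`.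
[cite: Balaban1983RegularityDecay, Theorem (Prop. 2.1 of [1]) (1.10) p.573; dictionary (Ω = ηℤ^{d+1}, A = 0)] -/
theorem GkLat_weightedRow_summable {x : Fin (d + 1) → ℤ}
    (hF : ∀ F : Finset (Fin (d + 1) → ℤ),
      ∑ x' ∈ F, |GkLat ℓ k a m2 x x'| * Real.exp (δ₀ * supNorm (x - x') / (((ℓ + 1) ^ k : ℕ) : ℝ)) ≤ c₀) :
    Summable fun x' => |GkLat ℓ k a m2 x x'| * Real.exp (δ₀ * supNorm (x - x') / (((ℓ + 1) ^ k : ℕ) : ℝ)) :=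
  summable_of_sum_le (fun _ => mul_nonneg (abs_nonneg _) (Real.exp_pos _).le) hF

/-- **(1.10) FOR `Ω = ηℤ^{d+1}` AS A SERIES**: `Σ_{x′ ∈ ℤ^{d+1}} |G_k(0)(x,x′)|·e^{δ₀|x−x′|_∞/L^k} ≤ c₀`.
[cite: Balaban1983RegularityDecay, Theorem (Prop. 2.1 of [1]) (1.10) p.573; dictionary (Ω = ηℤ^{d+1}, A = 0)] -/
theorem GkLat_weightedRow_tsum_le {x : Fin (d + 1) → ℤ}
    (hF : ∀ F : Finset (Fin (d + 1) → ℤ),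
      ∑ x' ∈ F, |GkLat ℓ k a m2 x x'| * Real.exp (δ₀ * supNorm (x - x') / (((ℓ + 1) ^ k : ℕ) : ℝ)) ≤ c₀) :
    ∑' x', |GkLat ℓ k a m2 x x'| * Real.exp (δ₀ * supNorm (x - x') / (((ℓ + 1) ^ k : ℕ) : ℝ)) ≤ c₀ :=
  Real.tsum_le_of_sum_le (fun _ => mul_nonneg (abs_nonneg _) (Real.exp_pos _).le) hF

/-- **POINTWISE EXPONENTIAL DECAY OF THE INFINITE-LATTICE PROPAGATOR, EVERY DIMENSION**:
`|G_k(0)(x,x′)| ≤ c₀·e^{−δ₀|x−x′|_∞/L^k}` (the one-point partial sum).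
[cite: Balaban1983RegularityDecay, Theorem (Prop. 2.1 of [1]) (1.10) p.573; dictionary (Ω = ηℤ^{d+1}, A = 0, f = δ_{x′})] -/
theorem GkLat_abs_le {x : Fin (d + 1) → ℤ}
    (hF : ∀ F : Finset (Fin (d + 1) → ℤ),
      ∑ x' ∈ F, |GkLat ℓ k a m2 x x'| * Real.exp (δ₀ * supNorm (x - x') / (((ℓ + 1) ^ k : ℕ) : ℝ)) ≤ c₀)
    (x' : Fin (d + 1) → ℤ) :
    |GkLat ℓ k a m2 x x'| ≤ c₀ * Real.exp (-(δ₀ * supNorm (x - x') / (((ℓ + 1) ^ k : ℕ) : ℝ))) := by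
  have h1 := hF {x'}
  rw [Finset.sum_singleton] at h1
  rw [Real.exp_neg, ← div_eq_mul_inv, le_div_iff₀ (Real.exp_pos _)]
  exact h1

/-- **LEMMA 2.2 (2.17) AT `p = q = ∞` ON THE LATTICE, ROW FORM**: the plain rows are summable, `Σ_{x′}|G_k(0)(x,x′)| ≤ c₀`.
[cite: Balaban1983RegularityDecay, Lemma 2.2 (2.17) p.578, (1.10) p.573; dictionary (□ ↦ ηℤ^{d+1}, A = 0)] -/
theorem GkLat_row_summable (hδ₀ : 0 ≤ δ₀) {x : Fin (d + 1) → ℤ}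
    (hF : ∀ F : Finset (Fin (d + 1) → ℤ),
      ∑ x' ∈ F, |GkLat ℓ k a m2 x x'| * Real.exp (δ₀ * supNorm (x - x') / (((ℓ + 1) ^ k : ℕ) : ℝ)) ≤ c₀) :
    Summable (fun x' => |GkLat ℓ k a m2 x x'|) ∧ ∑' x', |GkLat ℓ k a m2 x x'| ≤ c₀ := by
  have hle : ∀ x', |GkLat ℓ k a m2 x x'|
      ≤ |GkLat ℓ k a m2 x x'| * Real.exp (δ₀ * supNorm (x - x') / (((ℓ + 1) ^ k : ℕ) : ℝ)) := fun x' =>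
    le_mul_of_one_le_right (abs_nonneg _)
      (Real.one_le_exp (div_nonneg (mul_nonneg hδ₀ (supNorm_nonneg _)) (Nat.cast_nonneg _)))
  have hs := GkLat_weightedRow_summable hF
  refine ⟨Summable.of_nonneg_of_le (fun _ => abs_nonneg _) hle hs, ?_⟩
  exact (Summable.tsum_le_tsum hle (Summable.of_nonneg_of_le (fun _ => abs_nonneg _) hle hs) hs).trans
    (GkLat_weightedRow_tsum_le hF)

end Consequences

/-- **LEMMA 2.2 (2.17) AT `p = q = 1` / THE COLUMN FORM** (by the symmetry `G_k(0)(x,x′) = G_k(0)(x′,x)`,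
`B3GkZeroLattice.GkLat_comm`): with the constants of `GkLat_weightedRow_le`, every COLUMN of `G_k(0)` is summable with the
exponential weight and `Σ_x |G_k(0)(x,x′)|·e^{δ₀|x−x′|_∞/L^k} ≤ c₀`, in particular `Σ_x|G_k(0)(x,x′)| ≤ c₀`.
[cite: Balaban1983RegularityDecay, Lemma 2.2 (2.17) p.578, (1.10) p.573; dictionary (□ ↦ ηℤ^{d+1}, A = 0)] -/
theorem GkLat_weightedCol_le (d ℓ : ℕ) (hℓ : 1 ≤ ℓ) (amin aplus m2plus : ℝ) (ha : 0 < amin) :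
    ∃ δ₀ c₀ : ℝ, 0 < δ₀ ∧ 0 < c₀ ∧ ∀ (k : ℕ), 1 ≤ k → ∀ (a m2 : ℝ), amin ≤ a → a ≤ aplus → 0 ≤ m2 → m2 ≤ m2plus →
      ∀ (x' : Fin (d + 1) → ℤ),
        (∀ F : Finset (Fin (d + 1) → ℤ),
          ∑ x ∈ F, |GkLat ℓ k a m2 x x'| * Real.exp (δ₀ * supNorm (x - x') / (((ℓ + 1) ^ k : ℕ) : ℝ)) ≤ c₀) ∧
        (Summable fun x => |GkLat ℓ k a m2 x x'| * Real.exp (δ₀ * supNorm (x - x') / (((ℓ + 1) ^ k : ℕ) : ℝ))) ∧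
        (Summable fun x => |GkLat ℓ k a m2 x x'|) ∧ ∑' x, |GkLat ℓ k a m2 x x'| ≤ c₀ := by
  obtain ⟨δ₀, c₀, hδ₀, hc₀, h⟩ := GkLat_weightedRow_le d ℓ hℓ amin aplus m2plus ha
  refine ⟨δ₀, c₀, hδ₀, hc₀, ?_⟩
  intro k hk a m2 h1 h2 h3 h4 x'
  have hF : ∀ F : Finset (Fin (d + 1) → ℤ),
      ∑ x ∈ F, |GkLat ℓ k a m2 x x'| * Real.exp (δ₀ * supNorm (x - x') / (((ℓ + 1) ^ k : ℕ) : ℝ)) ≤ c₀ := by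
    intro F
    have := h k hk a m2 h1 h2 h3 h4 x' F
    refine le_of_eq_of_le (Finset.sum_congr rfl fun x _ => ?_) this
    rw [GkLat_comm, supNorm_sub_comm]
  have hF' : ∀ F : Finset (Fin (d + 1) → ℤ),
      ∑ x ∈ F, |GkLat ℓ k a m2 x' x| * Real.exp (δ₀ * supNorm (x' - x) / (((ℓ + 1) ^ k : ℕ) : ℝ)) ≤ c₀ :=
    fun F => h k hk a m2 h1 h2 h3 h4 x' F
  have hrow := GkLat_row_summable hδ₀.le hF'
  refine ⟨hF, summable_of_sum_le (fun _ => mul_nonneg (abs_nonneg _) (Real.exp_pos _).le) hF, ?_, ?_⟩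
  · exact hrow.1.congr fun x => by rw [GkLat_comm]
  · calc ∑' x, |GkLat ℓ k a m2 x x'| = ∑' x, |GkLat ℓ k a m2 x' x| := tsum_congr fun x => by rw [GkLat_comm]
      _ ≤ c₀ := hrow.2

/-- **(1.10) IN THE PRINTED SHAPE, `Ω = ηℤ^{d+1}`, `A = 0`**: with the constants of `GkLat_weightedRow_le`, for every bounded
`f : ηℤ^{d+1} → ℂ` (`‖f(x′)‖ ≤ F_∞`) and every `D` with `D ≤ |x − x′|_∞` on `supp f` (e.g. the sup-distance from `x` to
`supp f` in fine units), the series `(G_k(0)f)(x) = Σ_{x′}G_k(0)(x,x′)f(x′)` converges absolutely and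
`|(G_k(0)f)(x)| ≤ c₀·e^{−δ₀D/L^k}·F_∞` — «|(G_k(Ω,A)f)(x)| ≦ c₀exp(−δ₀dist(x, supp f))‖f‖_∞».
[cite: Balaban1983RegularityDecay, Theorem (Prop. 2.1 of [1]) (1.10) p.573; dictionary (Ω = ηℤ^{d+1}, A = 0, sup-norm distance in units of η)] -/
theorem GkLat_apply_le {ℓ k : ℕ} {a m2 δ₀ c₀ : ℝ} (hδ₀ : 0 ≤ δ₀) {x : Fin (d + 1) → ℤ}
    (hF : ∀ F : Finset (Fin (d + 1) → ℤ),
      ∑ x' ∈ F, |GkLat ℓ k a m2 x x'| * Real.exp (δ₀ * supNorm (x - x') / (((ℓ + 1) ^ k : ℕ) : ℝ)) ≤ c₀)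
    {f : (Fin (d + 1) → ℤ) → ℂ} {Fsup D : ℝ} (hf : ∀ x', ‖f x'‖ ≤ Fsup)
    (hD : ∀ x', f x' ≠ 0 → D ≤ supNorm (x - x')) :
    (Summable fun x' => ((GkLat ℓ k a m2 x x' : ℝ) : ℂ) * f x') ∧
      ‖∑' x', ((GkLat ℓ k a m2 x x' : ℝ) : ℂ) * f x'‖
        ≤ c₀ * Real.exp (-(δ₀ * D / (((ℓ + 1) ^ k : ℕ) : ℝ))) * Fsup := by
  set n : ℝ := (((ℓ + 1) ^ k : ℕ) : ℝ) with hn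
  have hn0 : 0 ≤ n := Nat.cast_nonneg _
  have hFsup : 0 ≤ Fsup := (norm_nonneg _).trans (hf x)
  -- the majorant `e^{−δ₀D/n}·F_∞·(|G(x,x′)|e^{δ₀|x−x′|/n})`
  set g : (Fin (d + 1) → ℤ) → ℝ := fun x' =>
    Real.exp (-(δ₀ * D / n)) * Fsup * (|GkLat ℓ k a m2 x x'| * Real.exp (δ₀ * supNorm (x - x') / n)) with hg
  have hmaj : ∀ x', ‖((GkLat ℓ k a m2 x x' : ℝ) : ℂ) * f x'‖ ≤ g x' := by
    intro x'
    by_cases hfx : f x' = 0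
    · rw [hfx, mul_zero, norm_zero, hg]
      exact mul_nonneg (mul_nonneg (Real.exp_pos _).le hFsup) (mul_nonneg (abs_nonneg _) (Real.exp_pos _).le)
    · have hDx := hD x' hfx
      rw [norm_mul, Complex.norm_real, Real.norm_eq_abs, hg]
      have hexp : (1 : ℝ) ≤ Real.exp (-(δ₀ * D / n)) * Real.exp (δ₀ * supNorm (x - x') / n) := by
        rw [← Real.exp_add]
        apply Real.one_le_exp
        rw [← sub_eq_neg_add, ← sub_div, ← mul_sub]
        exact div_nonneg (mul_nonneg hδ₀ (sub_nonneg.2 hDx)) hn0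
      calc |GkLat ℓ k a m2 x x'| * ‖f x'‖ ≤ |GkLat ℓ k a m2 x x'| * Fsup :=
            mul_le_mul_of_nonneg_left (hf x') (abs_nonneg _)
        _ = |GkLat ℓ k a m2 x x'| * Fsup * 1 := (mul_one _).symm
        _ ≤ |GkLat ℓ k a m2 x x'| * Fsup
              * (Real.exp (-(δ₀ * D / n)) * Real.exp (δ₀ * supNorm (x - x') / n)) :=
            mul_le_mul_of_nonneg_left hexp (mul_nonneg (abs_nonneg _) hFsup)
        _ = Real.exp (-(δ₀ * D / n)) * Fsup * (|GkLat ℓ k a m2 x x'| * Real.exp (δ₀ * supNorm (x - x') / n)) := by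
            ring
  have hgs : Summable g := (GkLat_weightedRow_summable hF).mul_left _
  refine ⟨Summable.of_norm_bounded hgs hmaj, ?_⟩
  refine (tsum_of_norm_bounded hgs.hasSum hmaj).trans ?_
  rw [hg, tsum_mul_left]
  have h0 : 0 ≤ Real.exp (-(δ₀ * D / n)) * Fsup := mul_nonneg (Real.exp_pos _).le hFsup
  calc Real.exp (-(δ₀ * D / n)) * Fsup * ∑' x', |GkLat ℓ k a m2 x x'| * Real.exp (δ₀ * supNorm (x - x') / n)
      ≤ Real.exp (-(δ₀ * D / n)) * Fsup * c₀ :=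
        mul_le_mul_of_nonneg_left (GkLat_weightedRow_tsum_le hF) h0
    _ = c₀ * Real.exp (-(δ₀ * D / n)) * Fsup := by ring

/-! ## §2 The `ℓ²` bridge: the columns of `G_k(0)` are THE square-summable solutions of (2.44); `G_k(0) = G246` -/

section Bridge

variable {ℓ k : ℕ} {a m2 : ℝ}

/-- **THE COLUMNS OF `G_k(0)` SOLVE THE BASIC EQUATION (2.44) WITH A POINT SOURCE**, in the operator form of the `B4Green244`
lineage: `(−Δ^ξ + m² + a_kQ_k^*Q_k)G_k(0)(·,x′) = δ_{x′}` on all of `ℤ^{d+1}` (`B3GkZeroLattice.green_GkLat` through the dictionary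
`B4Green242Bridge.opK_dictionary`). [cite: Balaban1983RegularityDecay, (2.44) p.584 with (1.6) p.572; Balaban1983Higgs3, p.433 («we substitute G_k(□,0) = G_k(0) + δG_k(□,ηZ^d,0)»)] -/
theorem opD_GkLat_col (hℓ : 1 ≤ ℓ) (hk : 1 ≤ k) (ha : 0 < a) (hm : 0 ≤ m2) (x' x : Fin (d + 1) → ℤ) :
    opD ((ℓ + 1) ^ k) (B1.aSeq a ((ℓ : ℝ) + 1) k) m2 (fun z => ((GkLat ℓ k a m2 z x' : ℝ) : ℂ)) x
      = if x = x' then 1 else 0 := by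
  haveI : NeZero ((ℓ + 1) ^ k) := ⟨pow_ne_zero _ (Nat.succ_ne_zero ℓ)⟩
  rw [← opK_dictionary ((ℓ + 1) ^ k) (one_le_n ℓ k)]
  have h := green_GkLat hℓ hk ha hm x x'
  have hcast : (∑ z ∈ opSupp ((ℓ + 1) ^ k) x,
      opK ((((ℓ + 1) ^ k : ℕ) : ℂ) ^ 2) (m2 : ℂ) (((B1.aSeq a ((ℓ : ℝ) + 1) k : ℝ) : ℂ)
        * ((((ℓ + 1) ^ k : ℕ) : ℂ) ^ (d + 1))⁻¹) ((ℓ + 1) ^ k) x z * ((GkLat ℓ k a m2 z x' : ℝ) : ℂ))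
      = ((∑ z ∈ opSupp ((ℓ + 1) ^ k) x,
          latOpK ((ℓ + 1) ^ k) (B1.aSeq a ((ℓ : ℝ) + 1) k) m2 x z * GkLat ℓ k a m2 z x' : ℝ) : ℂ) := by
    rw [Complex.ofReal_sum]
    refine Finset.sum_congr rfl fun z _ => ?_
    rw [Complex.ofReal_mul, opK_eq_ofReal_latOpK]
  rw [hcast, h]
  split_ifs <;> simp

/-- **THE COLUMNS OF `G_k(0)` ARE SUMMABLE** (`ℓ¹`; Lemma 2.2 at `p = q = 1`, `GkLat_weightedCol_le`).
[cite: Balaban1983RegularityDecay, Lemma 2.2 (2.17) p.578, (1.10) p.573; dictionary (□ ↦ ηℤ^{d+1}, A = 0)] -/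
theorem summable_GkLat_col (hℓ : 1 ≤ ℓ) (hk : 1 ≤ k) (ha : 0 < a) (hm : 0 ≤ m2) (x' : Fin (d + 1) → ℤ) :
    Summable fun z => ‖((GkLat ℓ k a m2 z x' : ℝ) : ℂ)‖ := by
  obtain ⟨δ₀, c₀, -, -, h⟩ := GkLat_weightedCol_le d ℓ hℓ a a m2 ha
  obtain ⟨-, -, hs, -⟩ := h k hk a m2 le_rfl le_rfl hm le_rfl x'
  exact hs.congr fun z => by rw [Complex.norm_real, Real.norm_eq_abs]

/-- **THE COLUMNS OF `G_k(0)` ARE SQUARE-SUMMABLE** — `G_k(0)(·,x′) ∈ ℓ²(ηℤ^{d+1})`.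
[cite: Balaban1983RegularityDecay, (1.6) p.572, (1.8) p.573; dictionary (Ω = ηℤ^{d+1}, A = 0)] -/
theorem summable_sq_GkLat_col (hℓ : 1 ≤ ℓ) (hk : 1 ≤ k) (ha : 0 < a) (hm : 0 ≤ m2) (x' : Fin (d + 1) → ℤ) :
    Summable fun z => ‖((GkLat ℓ k a m2 z x' : ℝ) : ℂ)‖ ^ 2 :=
  Literature.Analysis.FunctionSpaces.Torus.summable_norm_sq_of_summable_norm (summable_GkLat_col hℓ hk ha hm x')

/-- **UNIQUENESS: EVERY SQUARE-SUMMABLE SOLUTION OF `Dφ = δ_{x′}` IS THE COLUMN OF `G_k(0)`** (`B4Ineq227LatticeL2.opD_injective_l2_of_pos`,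
`min{8,a_k} + m² > 0`).  In particular the kernel `G_k(0)` built in `B3GkZeroLattice` along the centred cubes does not depend on
the exhaustion: any other construction producing square-summable columns with the lattice Green identity gives the same kernel —
it is the kernel of THE bounded inverse (1.6) on `ℓ²(ηℤ^{d+1})` («This bound justifies the definition (1.6)»).
[cite: Balaban1983RegularityDecay, (1.6) p.572, (1.8) p.573, (2.44) p.584; dictionary (Ω = ηℤ^{d+1}, A = 0)] -/
theorem eq_GkLat_col_of_opD_eq (hℓ : 1 ≤ ℓ) (hk : 1 ≤ k) (ha : 0 < a) (hm : 0 ≤ m2) (x' : Fin (d + 1) → ℤ)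
    {φ : (Fin (d + 1) → ℤ) → ℂ} (hφ : Summable fun z => ‖φ z‖ ^ 2)
    (h : ∀ x, opD ((ℓ + 1) ^ k) (B1.aSeq a ((ℓ : ℝ) + 1) k) m2 φ x = if x = x' then 1 else 0) :
    φ = fun z => ((GkLat ℓ k a m2 z x' : ℝ) : ℂ) := by
  haveI : NeZero ((ℓ + 1) ^ k) := ⟨pow_ne_zero _ (Nat.succ_ne_zero ℓ)⟩
  have hak : 0 < B1.aSeq a ((ℓ : ℝ) + 1) k := B1.aSeq_pos ha (one_lt_L_real hℓ) hk
  have hγ : 0 < min 8 (B1.aSeq a ((ℓ : ℝ) + 1) k) + m2 := add_pos_of_pos_of_nonneg (lt_min (by norm_num) hak) hm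
  exact opD_injective_l2_of_pos ((ℓ + 1) ^ k) hak.le hm hγ hφ (summable_sq_GkLat_col hℓ hk ha hm x')
    fun x => by rw [h x, opD_GkLat_col hℓ hk ha hm x' x]

/-- kernel: the point source `δ_{x′}` is summable. [folklore] -/
private theorem summable_norm_delta (x' : Fin (d + 1) → ℤ) :
    Summable fun z : Fin (d + 1) → ℤ => ‖(if z = x' then (1 : ℂ) else 0)‖ := by
  refine summable_of_ne_finset_zero (s := {x'}) fun z hz => ?_
  rw [Finset.mem_singleton] at hz
  simp [hz]

/-- **`G_k(0) = G_j` OF (2.46): THE THERMODYNAMIC-LIMIT PROPAGATOR OF [B3] p. 433 IS THE FOURIER-BUILT FREE PROPAGATOR OF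
[B4]** (`m² > 0`): `G_k(0)(·,x′) = G246 n a_k m² δ_{x′}` — «Defining the propagator G_j, φ₀ = G_jf» for `f = δ_{x′}`, both sides
being THE square-summable solution of (2.44) (`B4Eq246SquareSummable.G246_eq_of_solution_l2`).
[cite: Balaban1983RegularityDecay, (2.44)–(2.46) p.584; Balaban1983Higgs3, p.433 («we substitute G_k(□,0) = G_k(0) + δG_k(□,ηZ^d,0)»)] -/
theorem GkLat_col_eq_G246 (hℓ : 1 ≤ ℓ) (hk : 1 ≤ k) (ha : 0 < a) (hm : 0 < m2) (x' : Fin (d + 1) → ℤ) :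
    (fun z => ((GkLat ℓ k a m2 z x' : ℝ) : ℂ))
      = G246 ((ℓ + 1) ^ k) (B1.aSeq a ((ℓ : ℝ) + 1) k) m2 (fun z => if z = x' then 1 else 0) := by
  haveI : NeZero ((ℓ + 1) ^ k) := ⟨pow_ne_zero _ (Nat.succ_ne_zero ℓ)⟩
  have hak : 0 < B1.aSeq a ((ℓ : ℝ) + 1) k := B1.aSeq_pos ha (one_lt_L_real hℓ) hk
  exact G246_eq_of_solution_l2 ((ℓ + 1) ^ k) (Nat.succ_pos d) hak.le hm (summable_norm_delta x')
    (summable_sq_GkLat_col hℓ hk ha hm.le x') (opD_GkLat_col hℓ hk ha hm.le x')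

/-- **(1.10) FOR THE (2.46)-PROPAGATOR WITH THE LITERAL COEFFICIENT `a` OF (1.6)**: there are `δ₀, c₀ > 0` (on `d`, `L`, the
window) such that for every `k ≥ 1`, `a ∈ [a₋,a₊]`, `m² ∈ ]0,m²₊]` and all `x, x′`:
`|(G246 n a m² δ_{x′})(x)| ≤ c₀·e^{−δ₀|x−x′|_∞/L^k}` — the kernel of the free propagator `G_j` of p. 584 decays exponentially,
uniformly in the scale (`a = (a/c_k)_k`, `B4Thm110ZeroBox.aSeq_div_cK`, and `GkLat_col_eq_G246`).
[cite: Balaban1983RegularityDecay, Theorem (Prop. 2.1 of [1]) (1.10) p.573, (2.44)–(2.46) p.584; dictionary (Ω = ξℤ^{d+1}, A = 0, f = δ_{x′})] -/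
theorem G246_kernel_abs_le (d ℓ : ℕ) (hℓ : 1 ≤ ℓ) (amin aplus m2plus : ℝ) (ha : 0 < amin) :
    ∃ δ₀ c₀ : ℝ, 0 < δ₀ ∧ 0 < c₀ ∧ ∀ (k : ℕ), 1 ≤ k → ∀ (a m2 : ℝ), amin ≤ a → a ≤ aplus → 0 < m2 → m2 ≤ m2plus →
      ∀ x x' : Fin (d + 1) → ℤ,
        ‖G246 ((ℓ + 1) ^ k) a m2 (fun z => if z = x' then 1 else 0) x‖
          ≤ c₀ * Real.exp (-(δ₀ * supNorm (x - x') / (((ℓ + 1) ^ k : ℕ) : ℝ))) := by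
  obtain ⟨hr0, hr1⟩ := Linv_sq_bounds hℓ
  obtain ⟨δ₀, c₀, hδ₀, hc₀, h⟩ :=
    GkLat_weightedRow_le d ℓ hℓ amin (aplus / (1 - ((((ℓ : ℝ) + 1)) ^ 2)⁻¹)) m2plus ha
  refine ⟨δ₀, c₀, hδ₀, hc₀, ?_⟩
  intro k hk a m2 h1 h2 h3 h4 x x'
  have hc := cK_pos hℓ hk
  have hA1 : amin ≤ a / cK ℓ k := by
    rw [le_div_iff₀ hc]
    calc amin * cK ℓ k ≤ amin * 1 := mul_le_mul_of_nonneg_left (cK_le_one hℓ hk) ha.le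
      _ ≤ a := by linarith
  have hA2 : a / cK ℓ k ≤ aplus / (1 - ((((ℓ : ℝ) + 1)) ^ 2)⁻¹) :=
    div_le_div₀ (by linarith) h2 (by linarith) (oneSub_le_cK hℓ hk)
  have hA0 : 0 < a / cK ℓ k := ha.trans_le hA1
  have hcol := GkLat_col_eq_G246 hℓ hk hA0 h3 x'
  rw [aSeq_div_cK hℓ hk] at hcol
  have hpt := congrFun hcol x
  rw [← hpt, Complex.norm_real, Real.norm_eq_abs]
  exact GkLat_abs_le (h k hk (a / cK ℓ k) m2 hA1 hA2 h3.le h4 x) x'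

/-- **`G_k(0)` ON FINITELY SUPPORTED DATA: `ℓ¹`, `ℓ²`, AND THE EQUATION** — for `f` supported in a finite set `S`, the field
`(G_k(0)f)(z) = Σ_{x′ ∈ S} G_k(0)(z,x′)f(x′)` is summable, square-summable and solves `(−Δ^ξ + m² + a_kQ_k^*Q_k)(G_k(0)f) = f`.
[cite: Balaban1983RegularityDecay, (2.44) p.584 («Defining the propagator G_j, φ₀ = G_jf»), (1.6) p.572; dictionary (Ω = ηℤ^{d+1}, A = 0)] -/
theorem GkLat_apply_finsupp (hℓ : 1 ≤ ℓ) (hk : 1 ≤ k) (ha : 0 < a) (hm : 0 ≤ m2) (S : Finset (Fin (d + 1) → ℤ))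
    {f : (Fin (d + 1) → ℤ) → ℂ} (hf : ∀ z ∉ S, f z = 0) :
    (Summable fun z => ‖∑ x' ∈ S, ((GkLat ℓ k a m2 z x' : ℝ) : ℂ) * f x'‖) ∧
    (Summable fun z => ‖∑ x' ∈ S, ((GkLat ℓ k a m2 z x' : ℝ) : ℂ) * f x'‖ ^ 2) ∧
    ∀ x, opD ((ℓ + 1) ^ k) (B1.aSeq a ((ℓ : ℝ) + 1) k) m2
        (fun z => ∑ x' ∈ S, ((GkLat ℓ k a m2 z x' : ℝ) : ℂ) * f x') x = f x := by
  have h1 : Summable fun z => ‖∑ x' ∈ S, ((GkLat ℓ k a m2 z x' : ℝ) : ℂ) * f x'‖ := by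
    refine Summable.of_nonneg_of_le (fun _ => norm_nonneg _) (fun z => norm_sum_le _ _)
      (summable_sum fun x' _ => ?_)
    simp_rw [norm_mul]
    exact (summable_GkLat_col hℓ hk ha hm x').mul_right _
  refine ⟨h1, Literature.Analysis.FunctionSpaces.Torus.summable_norm_sq_of_summable_norm h1, fun x => ?_⟩
  rw [opD_finset_sum_mul]
  simp_rw [opD_GkLat_col hℓ hk ha hm]
  by_cases hx : x ∈ S
  · rw [Finset.sum_eq_single_of_mem x hx (fun x' _ hne => by rw [if_neg (Ne.symm hne), zero_mul])]
    simp
  · rw [hf x hx]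
    refine Finset.sum_eq_zero fun x' hx' => ?_
    rw [if_neg, zero_mul]
    rintro rfl
    exact hx hx'

/-- **`G_k(0)f = G_jf` FOR FINITELY SUPPORTED `f`** (`m² > 0`): the operator `G_k(0)` of [B3] p. 433 and the (2.46)-propagator
`G246` of [B4] agree on finitely supported data (both give THE `ℓ²` solution of (2.44)).
[cite: Balaban1983RegularityDecay, (2.44)–(2.46) p.584; Balaban1983Higgs3, p.433 («we substitute G_k(□,0) = G_k(0) + δG_k(□,ηZ^d,0)»)] -/
theorem GkLat_apply_eq_G246 (hℓ : 1 ≤ ℓ) (hk : 1 ≤ k) (ha : 0 < a) (hm : 0 < m2) (S : Finset (Fin (d + 1) → ℤ))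
    {f : (Fin (d + 1) → ℤ) → ℂ} (hf : ∀ z ∉ S, f z = 0) :
    (fun z => ∑ x' ∈ S, ((GkLat ℓ k a m2 z x' : ℝ) : ℂ) * f x')
      = G246 ((ℓ + 1) ^ k) (B1.aSeq a ((ℓ : ℝ) + 1) k) m2 f := by
  haveI : NeZero ((ℓ + 1) ^ k) := ⟨pow_ne_zero _ (Nat.succ_ne_zero ℓ)⟩
  have hak : 0 < B1.aSeq a ((ℓ : ℝ) + 1) k := B1.aSeq_pos ha (one_lt_L_real hℓ) hk
  obtain ⟨-, h2, h3⟩ := GkLat_apply_finsupp hℓ hk ha hm.le S hf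
  have hfs : Summable fun z => ‖f z‖ :=
    summable_of_ne_finset_zero (s := S) fun z hz => by rw [hf z hz, norm_zero]
  exact G246_eq_of_solution_l2 ((ℓ + 1) ^ k) (Nat.succ_pos d) hak.le hm hfs h2 h3

end Bridge

/-! ## §3 (1.8)/(2.28) positivity for `G_k(0)` on finitely supported data -/

section Positivity

variable {ℓ k : ℕ} {a m2 : ℝ}

/-- **`γ₀‖G_k(0)f‖² ≤ Re⟨G_k(0)f, f⟩`, `γ₀ = min{8,a_k} + m²`**: the lower bound (1.8)/(2.27) on `ℓ²(ηℤ^{d+1})`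
(`B4Ineq227LatticeL2.energy_lower_bound_l2`) at `φ = G_k(0)f`, using `Dφ = f` (`GkLat_apply_finsupp`); `f` finitely supported.
[cite: Balaban1983RegularityDecay, (1.8) p.573, (2.27)–(2.28) p.580; repaired constant min{8,a}+m² (census G-B4-03); dictionary (Ω = ηℤ^{d+1}, A = 0)] -/
theorem GkLat_form_lower (hℓ : 1 ≤ ℓ) (hk : 1 ≤ k) (ha : 0 < a) (hm : 0 ≤ m2) (S : Finset (Fin (d + 1) → ℤ))
    {f : (Fin (d + 1) → ℤ) → ℂ} (hf : ∀ z ∉ S, f z = 0) :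
    (min 8 (B1.aSeq a ((ℓ : ℝ) + 1) k) + m2)
        * ∑' z, ‖∑ x' ∈ S, ((GkLat ℓ k a m2 z x' : ℝ) : ℂ) * f x'‖ ^ 2
      ≤ (∑' z, conj (∑ x' ∈ S, ((GkLat ℓ k a m2 z x' : ℝ) : ℂ) * f x') * f z).re := by
  haveI : NeZero ((ℓ + 1) ^ k) := ⟨pow_ne_zero _ (Nat.succ_ne_zero ℓ)⟩
  have hak : 0 < B1.aSeq a ((ℓ : ℝ) + 1) k := B1.aSeq_pos ha (one_lt_L_real hℓ) hk
  obtain ⟨-, h2, h3⟩ := GkLat_apply_finsupp hℓ hk ha hm S hf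
  have h := energy_lower_bound_l2 ((ℓ + 1) ^ k) hak.le hm h2
  simp_rw [h3] at h
  exact h

/-- **(2.28) FOR `G_k(0)`: `‖G_k(0)f‖_{ℓ²} ≤ c₀‖f‖_{ℓ²}`, `c₀⁻¹ = min{8,a_k} + m²`** — for every finitely supported `f` on
`ηℤ^{d+1}`; from `‖Dφ‖₂ ≥ γ₀‖φ‖₂` (`B4Ineq227LatticeL2.norm_opD_ge`, the `ℓ²` form of (1.8)) at `φ = G_k(0)f`, `Dφ = f` — the
bounded-operator statement for the p. 433 propagator left open in `B3GkZeroLattice`.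
[cite: Balaban1983RegularityDecay, (2.28) p.580, (1.8) p.573; repaired constant min{8,a}+m² (census G-B4-03); dictionary (G_k(□,0) ↦ G_k(0) on ηℤ^{d+1}, A = 0)] -/
theorem GkLat_apply_l2_bound (hℓ : 1 ≤ ℓ) (hk : 1 ≤ k) (ha : 0 < a) (hm : 0 ≤ m2) (S : Finset (Fin (d + 1) → ℤ))
    {f : (Fin (d + 1) → ℤ) → ℂ} (hf : ∀ z ∉ S, f z = 0) :
    (min 8 (B1.aSeq a ((ℓ : ℝ) + 1) k) + m2)
        * Real.sqrt (∑' z, ‖∑ x' ∈ S, ((GkLat ℓ k a m2 z x' : ℝ) : ℂ) * f x'‖ ^ 2)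
      ≤ Real.sqrt (∑' z, ‖f z‖ ^ 2) := by
  haveI : NeZero ((ℓ + 1) ^ k) := ⟨pow_ne_zero _ (Nat.succ_ne_zero ℓ)⟩
  have hak : 0 < B1.aSeq a ((ℓ : ℝ) + 1) k := B1.aSeq_pos ha (one_lt_L_real hℓ) hk
  obtain ⟨-, h2, h3⟩ := GkLat_apply_finsupp hℓ hk ha hm S hf
  have h := norm_opD_ge ((ℓ + 1) ^ k) hak.le hm h2
  simp_rw [h3] at h
  exact h

/-- **«0 < G_k» FOR `G_k(0)` (NON-NEGATIVITY)**: `Re Σ_{x,x′} f̄(x)G_k(0)(x,x′)f(x′) ≥ (min{8,a_k} + m²)‖G_k(0)f‖² ≥ 0` for every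
finitely supported `f` — the positivity statement of (2.28) for the infinite-lattice propagator of [B3] p. 433, left open in
`B3GkZeroLattice`. [cite: Balaban1983RegularityDecay, (2.28) p.580, (1.8) p.573; dictionary (G_k(□,0) ↦ G_k(0) on ηℤ^{d+1})] -/
theorem GkLat_form_nonneg (hℓ : 1 ≤ ℓ) (hk : 1 ≤ k) (ha : 0 < a) (hm : 0 ≤ m2) (S : Finset (Fin (d + 1) → ℤ))
    {f : (Fin (d + 1) → ℤ) → ℂ} (hf : ∀ z ∉ S, f z = 0) :
    0 ≤ (∑ x ∈ S, conj (f x) * ∑ x' ∈ S, ((GkLat ℓ k a m2 x x' : ℝ) : ℂ) * f x').re := by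
  have hak : 0 < B1.aSeq a ((ℓ : ℝ) + 1) k := B1.aSeq_pos ha (one_lt_L_real hℓ) hk
  have h := GkLat_form_lower hℓ hk ha hm S hf
  have hts : (∑' z, conj (∑ x' ∈ S, ((GkLat ℓ k a m2 z x' : ℝ) : ℂ) * f x') * f z)
      = ∑ z ∈ S, conj (∑ x' ∈ S, ((GkLat ℓ k a m2 z x' : ℝ) : ℂ) * f x') * f z :=
    tsum_eq_sum fun z hz => by rw [hf z hz, mul_zero]
  have hconj : (∑ x ∈ S, conj (f x) * ∑ x' ∈ S, ((GkLat ℓ k a m2 x x' : ℝ) : ℂ) * f x')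
      = conj (∑ z ∈ S, conj (∑ x' ∈ S, ((GkLat ℓ k a m2 z x' : ℝ) : ℂ) * f x') * f z) := by
    rw [map_sum]
    exact Finset.sum_congr rfl fun z _ => by rw [map_mul, Complex.conj_conj, mul_comm]
  rw [hconj, Complex.conj_re, ← hts]
  have h0 : 0 ≤ (min 8 (B1.aSeq a ((ℓ : ℝ) + 1) k) + m2)
      * ∑' z, ‖∑ x' ∈ S, ((GkLat ℓ k a m2 z x' : ℝ) : ℂ) * f x'‖ ^ 2 :=
    mul_nonneg (add_nonneg (le_min (by norm_num) hak.le) hm) (tsum_nonneg fun _ => sq_nonneg _)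
  linarith

/-- **«0 < G_k» FOR `G_k(0)` (STRICT)**: `Re Σ_{x,x′} f̄(x)G_k(0)(x,x′)f(x′) > 0` for every non-zero finitely supported `f`
(`G_k(0)f ≠ 0` since `D(G_k(0)f) = f`). [cite: Balaban1983RegularityDecay, (2.28) p.580, (1.8) p.573; dictionary (G_k(□,0) ↦ G_k(0) on ηℤ^{d+1})] -/
theorem GkLat_form_pos (hℓ : 1 ≤ ℓ) (hk : 1 ≤ k) (ha : 0 < a) (hm : 0 ≤ m2) (S : Finset (Fin (d + 1) → ℤ))
    {f : (Fin (d + 1) → ℤ) → ℂ} (hf : ∀ z ∉ S, f z = 0) (hf0 : f ≠ 0) :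
    0 < (∑ x ∈ S, conj (f x) * ∑ x' ∈ S, ((GkLat ℓ k a m2 x x' : ℝ) : ℂ) * f x').re := by
  haveI : NeZero ((ℓ + 1) ^ k) := ⟨pow_ne_zero _ (Nat.succ_ne_zero ℓ)⟩
  have hak : 0 < B1.aSeq a ((ℓ : ℝ) + 1) k := B1.aSeq_pos ha (one_lt_L_real hℓ) hk
  have h := GkLat_form_lower hℓ hk ha hm S hf
  obtain ⟨-, h2, h3⟩ := GkLat_apply_finsupp hℓ hk ha hm S hf
  set φ : (Fin (d + 1) → ℤ) → ℂ := fun z => ∑ x' ∈ S, ((GkLat ℓ k a m2 z x' : ℝ) : ℂ) * f x' with hφ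
  have hts : (∑' z, conj (φ z) * f z) = ∑ z ∈ S, conj (φ z) * f z :=
    tsum_eq_sum fun z hz => by rw [hf z hz, mul_zero]
  have hconj : (∑ x ∈ S, conj (f x) * φ x) = conj (∑ z ∈ S, conj (φ z) * f z) := by
    rw [map_sum]
    exact Finset.sum_congr rfl fun z _ => by rw [map_mul, Complex.conj_conj, mul_comm]
  rw [hconj, Complex.conj_re, ← hts]
  -- `φ ≠ 0`, hence `Σ|φ|² > 0`
  have hne : ∃ z, φ z ≠ 0 := by
    by_contra hall
    push Not at hall
    apply hf0
    funext z
    have hz := h3 z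
    rw [← hz]
    have hφ0 : φ = fun _ => 0 := funext hall
    simp [hφ0, opD, B4Green244.negLap, B4Green244.blockAvg]
  obtain ⟨z₀, hz₀⟩ := hne
  have hpos : 0 < ∑' z, ‖φ z‖ ^ 2 :=
    lt_of_lt_of_le (by positivity) (h2.le_tsum z₀ fun z _ => sq_nonneg _)
  have hγ : 0 < min 8 (B1.aSeq a ((ℓ : ℝ) + 1) k) + m2 := add_pos_of_pos_of_nonneg (lt_min (by norm_num) hak) hm
  nlinarith [mul_pos hγ hpos]

end Positivity

/-! ## §4 Non-vacuity: the hypotheses are met (`d + 1 = 4`, `L = 2`, window `a ∈ [1/2, 2]`, `m² ∈ [0, 1]`) -/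

/-- the weighted row bound at the physical dimension `d + 1 = 4`, `L = 2`. -/
example : ∃ δ₀ c₀ : ℝ, 0 < δ₀ ∧ 0 < c₀ ∧ ∀ (k : ℕ), 1 ≤ k → ∀ (a m2 : ℝ), (1 / 2 : ℝ) ≤ a → a ≤ 2 → 0 ≤ m2 → m2 ≤ 1 →
      ∀ (x : Fin (3 + 1) → ℤ) (F : Finset (Fin (3 + 1) → ℤ)),
        ∑ x' ∈ F, |GkLat 1 k a m2 x x'| * Real.exp (δ₀ * supNorm (x - x') / (((1 + 1) ^ k : ℕ) : ℝ)) ≤ c₀ :=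
  GkLat_weightedRow_le 3 1 le_rfl (1 / 2) 2 1 (by norm_num)

/-- the bridge at `d + 1 = 4`, `L = 2`, `k = 1`, `a = 1`, `m² = 1`: the column of `G_1(0)` at the origin is the
(2.46)-propagator applied to `δ_0`. -/
example : (fun z => ((GkLat (d := 3) 1 1 1 1 z 0 : ℝ) : ℂ))
      = G246 ((1 + 1) ^ 1) (B1.aSeq 1 ((1 : ℕ) + 1 : ℝ) 1) 1 (fun z => if z = 0 then 1 else 0) :=
  GkLat_col_eq_G246 le_rfl le_rfl one_pos one_pos 0

/-- the quantifier prefix of the window theorems is inhabited (`k = 1`, `a = 1`, `m² = 0`). -/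
example : (1 : ℕ) ≤ 1 ∧ (1 / 2 : ℝ) ≤ 1 ∧ (1 : ℝ) ≤ 2 ∧ (0 : ℝ) ≤ 0 ∧ (0 : ℝ) ≤ 1 :=
  ⟨le_rfl, by norm_num, by norm_num, le_rfl, by norm_num⟩

end

end Literature.MathematicalPhysics.QuantumFieldTheory.Balaban1983to89.B4Thm110ZeroLattice
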